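import Mathlib
import HarnessLib
import Summits.PneNP.PneNP.Theses.AeaCutRectangles
import Summits.PneNP.PneNP.Theorems.AeaCutRectanglesDutyRectangles
import Summits.PneNP.PneNP.Theorems.AeaCutRectanglesDutyTransport

/-!
# Line `duty` for the crux `FoolingMeasure` (X1, stmt-PneNP-19727, route AeaCutRectangles)

Lead prover pnp-aea-p1 (g0).  The crux X1 asks for probability measures `μ_n` on loopless
non-3-colourable edge sets over `[n]` such that EVERY cut rectangle `𝓐 ⊗ 𝓑` over EVERY near-balanced
cut `B` inside NON-3-COL has mass `≤ 2^{-(n/2)·log₂ n - C·n}` (all `C`, infinitely many `n`).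

STRUCTURE THEOREM used by this line (landed helper `AeaCutRectanglesDutyRectangles`, p547226): the
maximal cut rectangles inside NON-3-COL over `B` are exactly the DUTY RECTANGLES `dutyRect B Φ`,
`Φ ⊆ ([n] → Fin 3)` ("Bob's edges inside `B` kill every colouring in `Φ`, Alice's edges meeting `[n] ∖ B`
kill every colouring outside `Φ`"), and X1 ⟺ its DUTY FORM (`foolingMeasure_iff_duty`).  So the crux is:

  construct `μ_n` with  `sup_{B near-balanced} sup_{Φ} μ_n(dutyRect B Φ) ≤ 2^{-(n/2)·log₂ n - C·n}`.

The skeleton: `FoolingMeasure_of stub_dutyConstruction` (with the proved `stub_transport` used inside), where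
* `stub_transport` (bookkeeping, PROVED — `AeaCutRectanglesDutyTransport.dutyFooling_transport`): a duty-
  fooling measure on any finite vertex type `V ≃ Fin n` transports to `Fin n`;
* `stub_dutyConstruction` (THE OPEN CONTENT = X1 in duty form on an arbitrary finite vertex type): for
  some `ε ∈ (0,1/4]`, every `C`, infinitely many `n`, a vertex type `V` with `|V| = n` and a probability
  measure on loopless non-3-colourable edge sets over `V` all of whose duty rectangles over near-balanced
  cuts have mass `≤ 2^{-(n/2)·log₂ n - C·n}`.

WHAT A CONSTRUCTION MUST SURVIVE (necessary conditions; evidence WITNESS-g0/g1, refuter note 16:01Z,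
this seat's NOTES §Analysis):
* (N1, singleton duties) both sides of every near-balanced cut carry min-entropy `≥ (n/2)·log₂ n + C·n`
  (kills orbit measures of `2^{o(n)}` graphs and all supports with `≤ n/2` edges inside some near-half);
* (N2, random dense duties) for `μ`-a.e. `G` and every near-balanced `B`, with `S` = colourings of `B`
  extendable over Alice's side and `T` = proper colourings of `G[B]`:  `|S| ≳ (n/2)·ln n · |T|`, and the
  same for the projections to any `Y ⊆ B` that already separate;
* (N3, local duties) no support graph carries, at any near-balanced cut, a split certificate of
  non-3-colourability on `≤ log₃ n − O(1)` vertices of `B` (no `K₄`, no small odd wheel, no `O(log n)`-vertex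
  4-critical configuration anywhere: under symmetrisation such a certificate is a duty rectangle of mass
  `≥ 2^{-3^y}·n^{-y}` ≫ threshold);
* (engine) product/transversal measures of unit systems need `(n/2)·log₂ n + C·n` SPLIT units at every
  near-balanced cut (`foolingMeasure_of_spreadSystem`, p541284); colour-twin units are never split by
  class-respecting bisections (`toft_not_spread`), free units are scarce in every synthesis so far
  (FREE-UNIT conjecture, WITNESS-g1 §6); relabelling entropy does NOT lower this bar (a random twist of
  Bob's side creates O(1)-size obstructions with polynomial probability, NOTES A3).

HONEST FRAMING: a restricted-model (cut-rectangle / nondeterministic-communication) witness for one rung of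
Fagin's complement ladder; nothing here bears on P vs NP.
-/

set_option linter.dupNamespace false

namespace Summit.PneNP.PneNP.Cruxes.FoolingMeasure.Duty

open Finset Filter
open Summit.PneNP.PneNP.Theorems.AeaCutRectanglesDutyRectangles
open Summit.PneNP.PneNP.Theorems.AeaCutRectanglesDutyTransport

/-- Statement of `stub_transport` (see its docstring). -/
def DutyTransport : Prop :=
  ∀ (V W : Type) [Fintype V] [DecidableEq V] [Fintype W] [DecidableEq W] (σ : V ≃ W) (P : ℕ → Prop)
    (δ : ℝ) (μ : Finset (Sym2 V) → ℝ),
    (∀ S, 0 ≤ μ S) → (∑ S, μ S = 1) →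
    (∀ S, μ S ≠ 0 → (∀ e ∈ S, ¬ e.IsDiag) ∧
      ¬ (SimpleGraph.fromEdgeSet (S : Set (Sym2 V))).Colorable 3) →
    (∀ B : Finset V, P B.card → ∀ Φ : Set (V → Fin 3), ∑ G ∈ dutyFinset B Φ, μ G ≤ δ) →
    ∃ μ' : Finset (Sym2 W) → ℝ, (∀ S, 0 ≤ μ' S) ∧ (∑ S, μ' S = 1) ∧
      (∀ S, μ' S ≠ 0 → (∀ e ∈ S, ¬ e.IsDiag) ∧
        ¬ (SimpleGraph.fromEdgeSet (S : Set (Sym2 W))).Colorable 3) ∧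
      ∀ B' : Finset W, P B'.card → ∀ Ψ : Set (W → Fin 3), ∑ G ∈ dutyFinset B' Ψ, μ' G ≤ δ

/-- Statement of `stub_dutyConstruction` (see its docstring). -/
def DutyConstruction : Prop :=
  ∃ ε : ℝ, 0 < ε ∧ ε ≤ 1 / 4 ∧ ∀ C : ℕ, ∃ᶠ n in Filter.atTop,
    ∃ (V : Type) (_ : Fintype V) (_ : DecidableEq V), Fintype.card V = n ∧
    ∃ μ : Finset (Sym2 V) → ℝ, (∀ S, 0 ≤ μ S) ∧ (∑ S, μ S = 1) ∧
      (∀ S, μ S ≠ 0 → (∀ e ∈ S, ¬ e.IsDiag) ∧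
        ¬ (SimpleGraph.fromEdgeSet (S : Set (Sym2 V))).Colorable 3) ∧
      ∀ B : Finset V, (1 / 2 - ε) * (n : ℝ) ≤ B.card → (B.card : ℝ) ≤ (1 / 2 + ε) * n →
        ∀ Φ : Set (V → Fin 3),
          ∑ G ∈ dutyFinset B Φ, μ G ≤ (2 : ℝ) ^ (-((n : ℝ) / 2 * Real.logb 2 n) - (C : ℝ) * n)

/-- **stub (bookkeeping, PROVED).** TRANSPORT: a duty-fooling measure on a finite vertex type `V` moves
along any bijection `σ : V ≃ W` (cuts of the same sizes, same bound).  Closed by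
`AeaCutRectanglesDutyTransport.dutyFooling_transport`. -/
theorem stub_transport : DutyTransport :=
  fun _ _ _ _ _ _ σ P δ μ h0 h1 hs hd => dutyFooling_transport σ P δ μ h0 h1 hs hd

/-- **stub (the crux content).** DUTY CONSTRUCTION: for some `ε ∈ (0,1/4]` and every `C`, for infinitely
many `n`, on SOME finite vertex type `V` with `|V| = n` (structured types welcome) there is a probability
measure `μ` on loopless non-3-colourable edge sets such that for every near-balanced cut `B`
(`(1/2−ε)n ≤ |B| ≤ (1/2+ε)n`) and EVERY duty `Φ ⊆ (V → Fin 3)` the duty rectangle `dutyRect B Φ` has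
`μ`-mass `≤ 2^{-(n/2)·log₂ n - C·n}`.  Equivalent to X1 (duty form + transport); see the module docstring
for the necessary conditions N1–N3 any candidate must pass.  Size: XL (= the crux). -/
theorem stub_dutyConstruction : DutyConstruction := by
  sorry

namespace Registered
/-- Alias of `DutyConstruction` keyed by the registered stub name (device of
`Cruxes/Capture/Lines/csp-spine-meet-to-join.lean`: the skeleton audit admits hypotheses by stub NAME). -/
abbrev stub_dutyConstruction : Prop := DutyConstruction
end Registered

/-- **The crux from the stubs.**  Transport the constructed measure to `Fin n` (the PROVED bookkeeping stub
`stub_transport`) and apply the duty form of X1 (`foolingMeasure_iff_duty`).  The only hypothesis is the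
registered open stub `stub_dutyConstruction`. -/
theorem FoolingMeasure_of
    (hC : Registered.stub_dutyConstruction) :
    Summit.PneNP.PneNP.Theses.AeaCutRectangles.FoolingMeasure := by
  have hT : DutyTransport := stub_transport
  rw [foolingMeasure_iff_duty]
  obtain ⟨ε, hε0, hε1, hfreq⟩ := hC
  refine ⟨ε, hε0, hε1, fun C => (hfreq C).mono fun n hn => ?_⟩
  obtain ⟨V, _, _, hcard, μ, h0, h1, hs, hd⟩ := hn
  obtain ⟨μ', h0', h1', hs', hd'⟩ := hT V (Fin n) (Fintype.equivFinOfCardEq hcard)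
    (fun b => (1 / 2 - ε) * (n : ℝ) ≤ b ∧ (b : ℝ) ≤ (1 / 2 + ε) * n)
    ((2 : ℝ) ^ (-((n : ℝ) / 2 * Real.logb 2 n) - (C : ℝ) * n)) μ h0 h1 hs
    (fun B hB Φ => hd B hB.1 hB.2 Φ)
  exact ⟨μ', h0', h1', hs', fun B hB1 hB2 Φ => hd' B ⟨hB1, hB2⟩ Φ⟩

/-- The crux, closed modulo the one open stub (for the audit's `closure.modulo` display). -/
theorem FoolingMeasure_holds_of_stubs : Summit.PneNP.PneNP.Theses.AeaCutRectangles.FoolingMeasure :=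
  FoolingMeasure_of stub_dutyConstruction

end Summit.PneNP.PneNP.Cruxes.FoolingMeasure.Duty
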